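import Literature.Geometry.Lorentzian.KerrTortoiseZones
import HarnessLib

/-!
# Arithmetic of the near-extremal threshold cone in the flux regime
(namespace `Literature.Geometry.Lorentzian.Kerr`.)

Elementary size relations between the frequency parameters of a separated mode `(ω, m, Λ)` of the wave
equation on a sub-extremal Kerr exterior `g_{M,a}` in the THRESHOLD CONE
`|ω − mω₊| ≤ ε₀|m|` (`ω₊ = a/(2Mr₊)`, Dafermos–Rodnianski–Shlapentokh-Rothman arXiv:1402.7034 §6;
Teixeira da Costa 2020 §6) restricted to the FLUX REGIME `δκ ≤ |ω − mω₊|` (`κ = Kerr.surfaceGravity`),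
for spins `M/2 ≤ |a| < M`, aperture `ε₀ ≤ 1/(16M)` and `0 < m`:

* `abs_horizonAngularVelocity_le` / `le_abs_horizonAngularVelocity` — `1/(8M) ≤ |ω₊| ≤ 1/(2M)`;
* `cone_abs_omega_bounds` — `1/(16M) ≤ |ω| ≤ m/M` (so `ω ≠ 0`), `|ω − mω₊| ≤ m/(16M)`;
* `coneMaster_bounds` — with the MASTER VARIABLE `Y := 8(1 + M + M⁻¹)⁴(1 + δ⁻¹)·Λ/κ` every atomic
  quantity of the flux-regime kernel bound is at most a power of `Y`:
  `1 ≤ Y`, `|σ|⁻¹ ≤ Y`, `σ² ≤ Y²`, `|ω| ≤ Y`, `|ω|⁻¹ ≤ Y`, `η⁻¹ ≤ Y`, `η² ≤ Y` (`η = min(δ,1)κ/2`),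
  `Λ ≤ Y`, `κ⁻¹ ≤ Y`, `M ≤ Y`, `M⁻¹ ≤ Y`, `M⁻² ≤ Y`, where `σ = ω − mω₊`.

This is the bookkeeping that turns the explicit envelope constants of `CarterFluxEnvelopes.lean` into a
bound `C(M, δ)·Λ^N·κ^{−N}` (Λ-polynomial cone kernel bound).

## References
* M. Dafermos, I. Rodnianski, Y. Shlapentokh-Rothman, arXiv:1402.7034, §6 (frequency ranges);
  key `DafermosRodnianskiShlapentokhrothman2014`.
* R. Teixeira da Costa, Commun. Math. Phys. 378 (2020), §6 (the superradiant threshold `ω = mω₊`).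
-/

noncomputable section

open Set

namespace Literature.Geometry.Lorentzian

namespace Kerr

/-! ### The horizon angular velocity for `M/2 ≤ |a| ≤ M` -/

/-- `|ω₊| ≤ 1/(2M)` for `|a| ≤ M`, `0 < M` (`ω₊ = a/(2Mr₊)`, `r₊ ≥ M`). [cite: DafermosRodnianskiShlapentokhrothman2014, §2] -/
theorem abs_horizonAngularVelocity_le {M a : ℝ} (hM : 0 < M) (haM : |a| ≤ M) :
    |horizonAngularVelocity M a| ≤ 1 / (2 * M) := by
  have hr : M ≤ rPlus M a := M_le_rPlus M a
  have hr0 : 0 < rPlus M a := hM.trans_le hr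
  unfold horizonAngularVelocity
  rw [abs_div, abs_of_pos (by positivity : 0 < 2 * M * rPlus M a), div_le_div_iff₀ (by positivity)
    (by positivity)]
  have : |a| ≤ rPlus M a := haM.trans hr
  nlinarith

/-- `1/(8M) ≤ |ω₊|` for `M/2 ≤ |a|`, `0 < M` (`r₊ ≤ 2M`). [cite: DafermosRodnianskiShlapentokhrothman2014, §2] -/
theorem le_abs_horizonAngularVelocity {M a : ℝ} (hM : 0 < M) (ha : M / 2 ≤ |a|) :
    1 / (8 * M) ≤ |horizonAngularVelocity M a| := by
  have hr : rPlus M a ≤ 2 * M := rPlus_le_two_mul_self hM.le a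
  have hr0 : 0 < rPlus M a := rPlus_pos hM a
  unfold horizonAngularVelocity
  rw [abs_div, abs_of_pos (by positivity : 0 < 2 * M * rPlus M a), div_le_div_iff₀ (by positivity)
    (by positivity)]
  nlinarith [mul_le_mul_of_nonneg_left hr (show (0 : ℝ) ≤ 2 * M from by positivity)]

/-- **Size of `ω` in the threshold cone**: for `M/2 ≤ |a| ≤ M`, `0 < m`, `|ω − mω₊| ≤ ε₀ m` with
`ε₀ ≤ 1/(16M)`: `1/(16M) ≤ |ω|`, `|ω| ≤ m/M` and `|ω − mω₊| ≤ m/(16M)`. [cite: DafermosRodnianskiShlapentokhrothman2014, §6] -/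
theorem cone_abs_omega_bounds {M a ω ε₀ : ℝ} {m : ℤ} (hM : 0 < M) (haM : |a| ≤ M) (ha : M / 2 ≤ |a|)
    (hm : 0 < m) (hε₀ : ε₀ ≤ 1 / (16 * M))
    (hcone : |ω - m * horizonAngularVelocity M a| ≤ ε₀ * |(m : ℝ)|) :
    1 / (16 * M) ≤ |ω| ∧ |ω| ≤ m / M ∧ |ω - m * horizonAngularVelocity M a| ≤ m / (16 * M) := by
  have hm1 : (1 : ℝ) ≤ m := by exact_mod_cast hm
  have hmabs : |(m : ℝ)| = m := abs_of_pos (by linarith)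
  rw [hmabs] at hcone
  have hup := abs_horizonAngularVelocity_le hM haM
  have hlow := le_abs_horizonAngularVelocity hM ha
  have hσ : |ω - m * horizonAngularVelocity M a| ≤ m / (16 * M) := by
    calc _ ≤ ε₀ * m := hcone
      _ ≤ 1 / (16 * M) * m := mul_le_mul_of_nonneg_right hε₀ (by linarith)
      _ = m / (16 * M) := by ring
  have hmω : |m * horizonAngularVelocity M a| = m * |horizonAngularVelocity M a| := by
    rw [abs_mul, hmabs]
  refine ⟨?_, ?_, hσ⟩
  · -- `|ω| ≥ |mω₊| − |ω − mω₊| ≥ m/(8M) − m/(16M) ≥ 1/(16M)`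
    have h1 : |m * horizonAngularVelocity M a| - |ω - m * horizonAngularVelocity M a| ≤ |ω| := by
      have := abs_sub ω (ω - m * horizonAngularVelocity M a)
      rw [sub_sub_cancel] at this
      linarith
    have h2 : m * (1 / (8 * M)) ≤ |m * horizonAngularVelocity M a| := by
      rw [hmω]; exact mul_le_mul_of_nonneg_left hlow (by linarith)
    have h3 : 1 / (16 * M) ≤ m * (1 / (8 * M)) - m / (16 * M) := by
      have e : m * (1 / (8 * M)) - m / (16 * M) = m * (1 / (16 * M)) := by field_simp; ring
      rw [e]
      exact le_mul_of_one_le_left (by positivity) hm1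
    linarith
  · -- `|ω| ≤ |mω₊| + |ω − mω₊| ≤ m/(2M) + m/(16M) ≤ m/M`
    have h1 : |ω| ≤ |m * horizonAngularVelocity M a| + |ω - m * horizonAngularVelocity M a| := by
      have := abs_add_le (m * horizonAngularVelocity M a) (ω - m * horizonAngularVelocity M a)
      rwa [add_sub_cancel] at this
    have h2 : |m * horizonAngularVelocity M a| ≤ m * (1 / (2 * M)) := by
      rw [hmω]; exact mul_le_mul_of_nonneg_left hup (by linarith)
    have h3 : m * (1 / (2 * M)) + m / (16 * M) ≤ m / M := by
      have e : m * (1 / (2 * M)) + m / (16 * M) = 9 / 16 * (m / M) := by field_simp; ring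
      rw [e]
      have : 0 ≤ (m : ℝ) / M := by positivity
      nlinarith
    linarith

/-- **Master-variable bookkeeping for the flux regime.** With `Y := 8(1 + M + M⁻¹)⁴(1 + δ⁻¹)·Λ/κ`,
`σ := ω − mω₊`, `η := min(δ,1)κ/2`, on the flux regime of the threshold cone (`M/2 ≤ |a| < M`,
admissible `(ω, m, Λ)` with `0 < m`, `|σ| ≤ ε₀ m`, `ε₀ ≤ 1/(16M)`, `δκ ≤ |σ|`, `0 < δ`):
`1 ≤ Y ∧ |σ|⁻¹ ≤ Y ∧ σ² ≤ Y² ∧ |ω| ≤ Y ∧ |ω|⁻¹ ≤ Y ∧ η⁻¹ ≤ Y ∧ η² ≤ Y ∧ Λ ≤ Y ∧ κ⁻¹ ≤ Y ∧ M ≤ Y ∧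
M⁻¹ ≤ Y ∧ (M²)⁻¹ ≤ Y`. [folklore] -/
theorem coneMaster_bounds {M a ω ε₀ δ Λ : ℝ} {m : ℤ} (hMa : IsSubextremal M a) (ha : M / 2 ≤ |a|)
    (hadm : IsAdmissibleTriple a ω m Λ) (hm : 0 < m) (hε₀ : ε₀ ≤ 1 / (16 * M))
    (hcone : |ω - m * horizonAngularVelocity M a| ≤ ε₀ * |(m : ℝ)|) (hδ : 0 < δ)
    (hflux : δ * surfaceGravity M a ≤ |ω - m * horizonAngularVelocity M a|) :
    let Y := 8 * (1 + M + M⁻¹) ^ 4 * (1 + δ⁻¹) * Λ / surfaceGravity M a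
    1 ≤ Y ∧ |ω - m * horizonAngularVelocity M a|⁻¹ ≤ Y ∧ (ω - m * horizonAngularVelocity M a) ^ 2 ≤ Y ^ 2 ∧
      |ω| ≤ Y ∧ |ω|⁻¹ ≤ Y ∧ (min δ 1 * surfaceGravity M a / 2)⁻¹ ≤ Y ∧
      (min δ 1 * surfaceGravity M a / 2) ^ 2 ≤ Y ∧ Λ ≤ Y ∧ (surfaceGravity M a)⁻¹ ≤ Y ∧ M ≤ Y ∧
      M⁻¹ ≤ Y ∧ (M ^ 2)⁻¹ ≤ Y := by
  intro Y
  have hM : 0 < M := hMa.pos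
  have haM : |a| ≤ M := le_of_lt hMa
  set κ := surfaceGravity M a with hκdef
  have hκ : 0 < κ := hMa.surfaceGravity_pos
  have hκle : κ ≤ 1 / (4 * M) := surfaceGravity_le hM a
  set σ := ω - m * horizonAngularVelocity M a with hσdef
  set B := 1 + M + M⁻¹ with hB
  have hMinv : 0 < M⁻¹ := inv_pos.2 hM
  have hB1 : 1 ≤ B := by rw [hB]; linarith [hMinv.le]
  have hBM : M ≤ B := by rw [hB]; linarith [hMinv.le]
  have hBMi : M⁻¹ ≤ B := by rw [hB]; linarith
  have hB0 : 0 < B := by linarith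
  have hB2 : B ≤ B ^ 2 := le_self_pow₀ hB1 two_ne_zero
  have hB3 : B ≤ B ^ 3 := le_self_pow₀ hB1 (by norm_num)
  have hB4 : B ≤ B ^ 4 := le_self_pow₀ hB1 (by norm_num)
  have hB23 : B ^ 2 ≤ B ^ 3 := pow_le_pow_right₀ hB1 (by norm_num)
  have hB24 : B ^ 2 ≤ B ^ 4 := pow_le_pow_right₀ hB1 (by norm_num)
  have hB41 : (1 : ℝ) ≤ B ^ 4 := one_le_pow₀ hB1
  have hB31 : (1 : ℝ) ≤ B ^ 3 := one_le_pow₀ hB1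
  have hMB : 1 ≤ M * B := by
    have e : M * B = M + M ^ 2 + 1 := by rw [hB]; field_simp
    rw [e]; have := sq_nonneg M; linarith
  have hδi : 0 < δ⁻¹ := inv_pos.2 hδ
  have hD1 : 1 ≤ 1 + δ⁻¹ := by linarith
  -- admissibility: `1 ≤ m ≤ Λ` (as reals)
  have hm1 : (1 : ℝ) ≤ m := by exact_mod_cast hm
  have hmΛ : (m : ℝ) ≤ Λ := by
    calc (m : ℝ) = m * 1 := (mul_one _).symm
      _ ≤ m * m := by gcongr
      _ = (m : ℝ) ^ 2 := (sq _).symm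
      _ ≤ Λ := hadm.sq_le
  have hΛ1 : 1 ≤ Λ := hm1.trans hmΛ
  -- `1/κ ≥ 4M`
  have hκinv : 4 * M ≤ κ⁻¹ := by
    rw [le_inv_comm₀ (by positivity) hκ]; simpa [one_div] using hκle
  have hκratio : 1 ≤ κ⁻¹ / (4 * M) := (one_le_div (by positivity)).2 hκinv
  -- notation for the constant `A₀ = 8 B⁴ (1 + δ⁻¹)`
  set A₀ := 8 * B ^ 4 * (1 + δ⁻¹) with hA₀
  have hA0 : 0 < A₀ := by positivity
  have hA8 : 8 * B ^ 4 ≤ A₀ := le_mul_of_one_le_right (by positivity) hD1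
  have hA1 : 1 ≤ A₀ := by linarith
  have hAδ : δ⁻¹ ≤ A₀ := by
    calc δ⁻¹ ≤ 1 + δ⁻¹ := by linarith
      _ = 1 * (1 + δ⁻¹) := (one_mul _).symm
      _ ≤ 8 * B ^ 4 * (1 + δ⁻¹) := by gcongr; linarith
  have hYdef : Y = A₀ * Λ * κ⁻¹ := by
    simp only [Y, hA₀, hB, div_eq_mul_inv]
    rw [hκdef]
  -- the master lower bounds
  have hY_A : A₀ * κ⁻¹ ≤ Y := by
    rw [hYdef]
    calc A₀ * κ⁻¹ = A₀ * 1 * κ⁻¹ := by ring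
      _ ≤ A₀ * Λ * κ⁻¹ := by gcongr
  have hY_B : 32 * B ^ 3 * (1 + δ⁻¹) ≤ Y := by
    refine le_trans ?_ hY_A
    calc 32 * B ^ 3 * (1 + δ⁻¹) ≤ 32 * B ^ 3 * (1 + δ⁻¹) * (M * B) :=
          le_mul_of_one_le_right (by positivity) hMB
      _ = A₀ * (4 * M) := by rw [hA₀]; ring
      _ ≤ A₀ * κ⁻¹ := by gcongr
  have hY32 : 32 * B ^ 3 ≤ Y := le_trans (le_mul_of_one_le_right (by positivity) hD1) hY_B
  have hYB3 : B ^ 3 ≤ Y := le_trans (by linarith [pow_pos hB0 3]) hY32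
  have hY1 : 1 ≤ Y := hB31.trans hYB3
  -- (κ⁻¹ ≤ Y), (Λ ≤ Y)
  have hκY : κ⁻¹ ≤ Y := by
    refine le_trans ?_ hY_A
    calc κ⁻¹ = 1 * κ⁻¹ := (one_mul _).symm
      _ ≤ A₀ * κ⁻¹ := by gcongr
  have hA4M : 1 ≤ A₀ * (4 * M) := by
    calc (1 : ℝ) ≤ 32 * B ^ 3 * (1 + δ⁻¹) :=
          one_le_mul_of_one_le_of_one_le (by linarith) hD1
      _ ≤ 32 * B ^ 3 * (1 + δ⁻¹) * (M * B) := le_mul_of_one_le_right (by positivity) hMB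
      _ = A₀ * (4 * M) := by rw [hA₀]; ring
  have hAκ1 : 1 ≤ A₀ * κ⁻¹ := hA4M.trans (by gcongr)
  have hΛY : Λ ≤ Y := by
    rw [hYdef]
    calc Λ = 1 * Λ := (one_mul _).symm
      _ ≤ (A₀ * κ⁻¹) * Λ := by gcongr
      _ = A₀ * Λ * κ⁻¹ := by ring
  -- `M`, `M⁻¹`, `M⁻²`
  have hMY : M ≤ Y := hBM.trans (hB3.trans hYB3)
  have hMiY : M⁻¹ ≤ Y := hBMi.trans (hB3.trans hYB3)
  have hMi2B : (M⁻¹) ^ 2 ≤ B ^ 2 := pow_le_pow_left₀ hMinv.le hBMi 2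
  have hM2Y : (M ^ 2)⁻¹ ≤ Y := by
    rw [← inv_pow]
    exact hMi2B.trans (hB23.trans hYB3)
  -- `Λ / M ≤ Y`
  have hΛMY : Λ * M⁻¹ ≤ Y := by
    rw [hYdef]
    have h1 : M⁻¹ ≤ A₀ * κ⁻¹ := by
      calc M⁻¹ = M⁻¹ * 1 := (mul_one _).symm
        _ ≤ M⁻¹ * (κ⁻¹ / (4 * M)) := by gcongr
        _ = (M⁻¹) ^ 2 / 4 * κ⁻¹ := by field_simp
        _ ≤ B ^ 2 / 4 * κ⁻¹ := by gcongr
        _ ≤ A₀ * κ⁻¹ := by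
            gcongr
            calc B ^ 2 / 4 ≤ B ^ 4 := by linarith [pow_pos hB0 4]
              _ ≤ 8 * B ^ 4 := by linarith [pow_pos hB0 4]
              _ ≤ A₀ := hA8
    calc Λ * M⁻¹ ≤ Λ * (A₀ * κ⁻¹) := by gcongr
      _ = A₀ * Λ * κ⁻¹ := by ring
  -- `ω` bounds
  obtain ⟨hω16, hωle, hσle⟩ := cone_abs_omega_bounds hM haM ha hm hε₀ hcone
  have hω0 : 0 < |ω| := lt_of_lt_of_le (by positivity) hω16
  have hωY : |ω| ≤ Y := by
    calc |ω| ≤ m / M := hωle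
      _ ≤ Λ / M := by gcongr
      _ = Λ * M⁻¹ := div_eq_mul_inv _ _
      _ ≤ Y := hΛMY
  have hωiY : |ω|⁻¹ ≤ Y := by
    have hMB3 : M ≤ B ^ 3 := hBM.trans hB3
    calc |ω|⁻¹ ≤ (1 / (16 * M))⁻¹ := by
          rw [inv_le_inv₀ hω0 (by positivity)]; exact hω16
      _ = 16 * M := by rw [one_div, inv_inv]
      _ ≤ 32 * B ^ 3 := by linarith
      _ ≤ Y := hY32
  -- `σ` bounds
  have hσpos : 0 < |σ| := lt_of_lt_of_le (by positivity) hflux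
  have hσiY : |σ|⁻¹ ≤ Y := by
    calc |σ|⁻¹ ≤ (δ * κ)⁻¹ := by rw [inv_le_inv₀ hσpos (by positivity)]; exact hflux
      _ = δ⁻¹ * κ⁻¹ := by rw [mul_inv]
      _ ≤ A₀ * κ⁻¹ := by gcongr
      _ ≤ Y := hY_A
  have hσY : |σ| ≤ Y := by
    calc |σ| ≤ m / (16 * M) := hσle
      _ ≤ m / M := by
          apply div_le_div_of_nonneg_left (by linarith) hM; linarith
      _ ≤ Λ / M := by gcongr
      _ = Λ * M⁻¹ := div_eq_mul_inv _ _
      _ ≤ Y := hΛMY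
  have hσ2Y : σ ^ 2 ≤ Y ^ 2 := by
    have := pow_le_pow_left₀ (abs_nonneg σ) hσY 2; rwa [sq_abs] at this
  -- `η` bounds
  have hmin : 0 < min δ 1 := by positivity
  have hη : 0 < min δ 1 * κ / 2 := by positivity
  have hηiY : (min δ 1 * κ / 2)⁻¹ ≤ Y := by
    have h1 : (min δ 1)⁻¹ ≤ 1 + δ⁻¹ := by
      rcases le_total δ 1 with h | h
      · rw [min_eq_left h]; linarith
      · rw [min_eq_right h, inv_one]; linarith
    have h2 : (2 : ℝ) ≤ 8 * B ^ 4 := by linarith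
    calc (min δ 1 * κ / 2)⁻¹ = 2 * (min δ 1)⁻¹ * κ⁻¹ := by
          rw [div_eq_mul_inv, mul_inv, mul_inv, inv_inv]; ring
      _ ≤ 2 * (1 + δ⁻¹) * κ⁻¹ := by gcongr
      _ ≤ 8 * B ^ 4 * (1 + δ⁻¹) * κ⁻¹ := by gcongr
      _ = A₀ * κ⁻¹ := by rw [hA₀]
      _ ≤ Y := hY_A
  have hη2Y : (min δ 1 * κ / 2) ^ 2 ≤ Y := by
    have h1 : min δ 1 * κ / 2 ≤ κ := by
      have : min δ 1 * κ ≤ 1 * κ := by gcongr; exact min_le_right _ _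
      linarith
    have h2 : κ ≤ M⁻¹ := by
      calc κ ≤ 1 / (4 * M) := hκle
        _ ≤ M⁻¹ := by rw [one_div, inv_le_inv₀ (by positivity) hM]; linarith
    calc (min δ 1 * κ / 2) ^ 2 ≤ κ ^ 2 := pow_le_pow_left₀ hη.le h1 2
      _ ≤ (M⁻¹) ^ 2 := pow_le_pow_left₀ hκ.le h2 2
      _ ≤ Y := hMi2B.trans (hB23.trans hYB3)
  exact ⟨hY1, hσiY, hσ2Y, hωY, hωiY, hηiY, hη2Y, hΛY, hκY, hMY, hMiY, hM2Y⟩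

end Kerr

end Literature.Geometry.Lorentzian

end
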